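import Summits.HodgeConjecture.HodgeConjecture.Theorems.H413ConjugatePartnerOfReprIndependence
import Summits.HodgeConjecture.HodgeConjecture.Theorems.H413LineTransportAllFrames
import HarnessLib

/-!
# FLOOR-0 P4, stub S5 (`StubT3bConjugatePartnerAt`) — THE FINAL CLOSER: representative independence at the pin's frame IS ★ S4a-at-every-frame

Cell hodgecm-mathlib (D-0151), FLOOR 0, crux item H413 = stmt-HodgeConjecture-24833; P4 line `Cruxes/H413/Lines/F0_P4AdmissibleOccursInH1.lean`
(ED. 3), stub S5 `StubT3bConjugatePartnerAt`.  Row «S5 FINAL CLOSER» of F0P4-plan (g3) 2026-08-31T00:49:30Z; author F0P4-p05 (g0).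
`--supports stmt-HodgeConjecture-24833`.  THEOREMS ONLY (no definition, no named fact, no instance, no `sorry`; 0 `Lines` imports).

★ p798585 `Theorems/H413ConjugatePartnerOfReprIndependence :: stubT3bConjugatePartnerAt_of_reprIndependence (hRI)` (F0P4-p03 (g0)) closed S5 MODULO
ONE displayed hypothesis `hRI` — the REPRESENTATIVE INDEPENDENCE of [Liu2021, Def. 4.11]'s carriers at the pin: for every face `(F, V)`, every
conjugate-symplectic `μ`, units `b, b'` of `F⁺` with `locF b = locF b'` and `ψ ∈ Chi`, a `U(V)(𝔸_f)`-equivariant `ω(μ, ⟨b⟩, ψ) ≃ₗ[ℂ] ω(μ, ⟨b'⟩, ψ)`.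
That hypothesis is, token for token, ★ p796928 `Theorems/H413LineTransportAllFrames :: lineTransportAt` (A-p17; = `exists_omegaAtLine_equiv_rhoVAtLine_of_locF_eq_frame`
at `N := 3`) at `L := ⟨K F⟩, e := e₁, dV := frameD V, θ := toHeckeCharacter (K F) μ, hθu := isUnitary_toHeckeCharacter …,
hθs := isSplittingChar_toHeckeCharacter_of_isConjugateSymplectic … hμ, a := b, a' := b', χ := ψ` — the splitting family `hsChiD ⟨K F⟩ e₁ …` of `hRI` IS
`lineTransportAt`'s `OmegaChiSplitting.hsChiD …` (same constant), so the instantiation is an `exact`.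

* **`reprIndependence_atFrame`** — `hRI`, proved (= ★ `lineTransportAt` instantiated);
* **`stubT3bConjugatePartnerAt_holds`** — the body of the line's `StubT3bConjugatePartnerAt` VERBATIM (as restated by ★ p798585), UNCONDITIONALLY:
  `:= stubT3bConjugatePartnerAt_of_reprIndependence reprIndependence_atFrame`.

HC_CM is proved only modulo the printed citations until rung 0 closes; this file proves nothing about them.

## References
* [Liu2021] Y. Liu, Camb. J. Math. 9 (2021), Def. 4.11–4.12 (l. 2083–2111); App. D §D.1 Step 1 footnote (l. 5215), Lem. D.1 (2) (l. 5231).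
* [GelbartRogawski1991] S. Gelbart, J. Rogawski, Invent. Math. 105 (1991), §3.1 Prop. 3.1.1 p. 455; Remark p. 457 L4–13.
-/

set_option autoImplicit false
set_option linter.dupNamespace false

noncomputable section

namespace Summit.HodgeConjecture.HodgeConjecture.Cruxes.H413.ConjugatePartner

open scoped TensorProduct Matrix ComplexConjugate
open NumberField NumberField.InfinitePlace NumberField.ComplexEmbedding IsDedekindDomain
open HodgeCM.Model HodgeCM.Model.LiuIndex HodgeCM.Model.TowerCarrier
open Summit.HodgeConjecture.CorCM.Model
open Literature.AlgebraicGeometry.Motives (CMType AbelianVariety)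
open Literature.AlgebraicGeometry.Liu2021 (IsAdmissibleElement isAdmissibleElement_conj_neg_iff)
open Literature.AlgebraicGeometry.HodgeTheory Literature.NumberTheory.Automorphic.PicardCM
open Literature.AlgebraicGeometry.ShimuraVarieties Literature.AlgebraicGeometry.ShimuraVarieties.UnitaryCanonicalModel
open Literature.NumberTheory.ComplexMultiplication Literature.NumberTheory.ComplexMultiplication.CMTypeOps
open Literature.NumberTheory.Automorphic Literature.NumberTheory.Automorphic.UnitaryGroup
open Literature.NumberTheory.Automorphic.IdeleClassGroup
open Literature.NumberTheory.Automorphic.Liu2021 Literature.NumberTheory.Automorphic.Liu2021.AppendixC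
open Literature.NumberTheory.Automorphic.Liu2021.Def411WeilCarriers
open Literature.NumberTheory.Automorphic.Liu2021.Def411WeilCarriersDoubling (isSplittingChar_toHeckeCharacter_of_isConjugateSymplectic)
open Summit.HodgeConjecture.CorCM.Transposition.OmegaTransport (realUnit)
open Summit.HodgeConjecture.CorCM.Transposition.OmegaChiSplitting (sChiD hsChiD)
open HodgeCM.Model.ArchSideTerm (e₁)
open Literature.NumberTheory.GelbartRogawski1991 Literature.NumberTheory.GelbartRogawski1991.UnitaryDualPair
open Literature.RepresentationTheory Literature.RepresentationTheory.Liu2021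
open Summit.HodgeConjecture.CorCM
open Summit.HodgeConjecture.CorCM.Transposition
open MulAction
open Literature.NumberTheory.GelbartRogawski1991.OscillatorTripleDictionary (rhoTriple)
open Summit.HodgeConjecture.CorCM.Lines.A3Liu413 (datum413)
open Summit.HodgeConjecture.HodgeConjecture.Cruxes.H413.MirrorAtPinLine
open Summit.HodgeConjecture.HodgeConjecture.Cruxes.H413.LineTransport (lineTransportAt)

set_option synthInstance.maxHeartbeats 400000 in
set_option maxHeartbeats 16000000 in
/-- **REPRESENTATIVE INDEPENDENCE AT THE PIN'S FRAME** (the hypothesis `hRI` of ★ `stubT3bConjugatePartnerAt_of_reprIndependence`, proved): for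
every face `(F, V)`, conjugate-symplectic `μ`, units `b, b'` of `F⁺` with `locF b = locF b'` and `ψ ∈ Chi`, the pin's carriers `ω(μ, ⟨b⟩, ψ)` and
`ω(μ, ⟨b'⟩, ψ)` are isomorphic `U(V)(𝔸_f)`-equivariantly — ★ `LineTransport.lineTransportAt` at `L := ⟨K F⟩`, `e := e₁`, `dV := frameD V`,
`θ := toHeckeCharacter (K F) μ`. [cite: Liu2021, Def. 4.11 (l. 2092–2096); App. D §D.1 Step 1 footnote (l. 5217), Steps 2–3 (l. 5217–5221)]
[cite: GelbartRogawski1991, §3.1 Prop. 3.1.1 p. 455 L1–3; Remark p. 457 L4–13] -/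
theorem reprIndependence_atFrame :
    ∀ (F : HodgeCM.CMField) {ι₁ : F →+* ℂ} (V : HodgeCM.HermSpace3 F ι₁)
      (μ : Literature.NumberTheory.Automorphic.IdeleClassGroup (HodgeCM.CMField.K F) →ₜ* Circle)
      (hμ : IsConjugateSymplectic (HodgeCM.CMField.K F) μ)
      (b b' : (↥(maximalRealSubfield (HodgeCM.CMField.K F)))ˣ)
      (hbb' : locF ↥(maximalRealSubfield (HodgeCM.CMField.K F)) (imagUnitSq (HodgeCM.CMField.K F)) b =
        locF ↥(maximalRealSubfield (HodgeCM.CMField.K F)) (imagUnitSq (HodgeCM.CMField.K F)) b')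
      (ψ : Chi ↥(maximalRealSubfield (HodgeCM.CMField.K F)) (HodgeCM.CMField.K F) (IsCMField.complexConj (HodgeCM.CMField.K F))),
      ∃ Ψ : omegaAtLine ↥(maximalRealSubfield (HodgeCM.CMField.K F)) (HodgeCM.CMField.K F) (IsCMField.complexConj (HodgeCM.CMField.K F)) 3 e₁
            (Matrix.diagonal (frameD V)) (complexConj_imagUnit (HodgeCM.CMField.K F)) (imagUnit_ne_zero (HodgeCM.CMField.K F))
            (imagUnit_mul_self (HodgeCM.CMField.K F)) (realDiagonal_isSymm (HodgeCM.CMField.K F) (frameD V) (frameD_real V))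
            (isUnit_det_realDiagonal (HodgeCM.CMField.K F) (frameD V) (frameD_real V) (frameD_ne V))
            (realDiagonal_map (HodgeCM.CMField.K F) (frameD V) (frameD_real V)).symm
            (hsChiD (⟨HodgeCM.CMField.K F⟩ : Summit.HodgeConjecture.CorCM.CMField) e₁ (frameD V) (frameD_real V) (frameD_ne V)
              (toHeckeCharacter (HodgeCM.CMField.K F) μ) (isUnitary_toHeckeCharacter (HodgeCM.CMField.K F) μ)
              (isSplittingChar_toHeckeCharacter_of_isConjugateSymplectic (HodgeCM.CMField.K F) μ hμ)) b ψ ≃ₗ[ℂ]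
          omegaAtLine ↥(maximalRealSubfield (HodgeCM.CMField.K F)) (HodgeCM.CMField.K F) (IsCMField.complexConj (HodgeCM.CMField.K F)) 3 e₁
            (Matrix.diagonal (frameD V)) (complexConj_imagUnit (HodgeCM.CMField.K F)) (imagUnit_ne_zero (HodgeCM.CMField.K F))
            (imagUnit_mul_self (HodgeCM.CMField.K F)) (realDiagonal_isSymm (HodgeCM.CMField.K F) (frameD V) (frameD_real V))
            (isUnit_det_realDiagonal (HodgeCM.CMField.K F) (frameD V) (frameD_real V) (frameD_ne V))
            (realDiagonal_map (HodgeCM.CMField.K F) (frameD V) (frameD_real V)).symm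
            (hsChiD (⟨HodgeCM.CMField.K F⟩ : Summit.HodgeConjecture.CorCM.CMField) e₁ (frameD V) (frameD_real V) (frameD_ne V)
              (toHeckeCharacter (HodgeCM.CMField.K F) μ) (isUnitary_toHeckeCharacter (HodgeCM.CMField.K F) μ)
              (isSplittingChar_toHeckeCharacter_of_isConjugateSymplectic (HodgeCM.CMField.K F) μ hμ)) b' ψ,
        ∀ (k : finAdelic ↥(maximalRealSubfield (HodgeCM.CMField.K F)) (HodgeCM.CMField.K F) (IsCMField.complexConj (HodgeCM.CMField.K F)) 3
            (Matrix.diagonal (frameD V))) x,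
          Ψ (rhoVAtLine ↥(maximalRealSubfield (HodgeCM.CMField.K F)) (HodgeCM.CMField.K F) (IsCMField.complexConj (HodgeCM.CMField.K F)) 3 e₁
              (Matrix.diagonal (frameD V)) (complexConj_imagUnit (HodgeCM.CMField.K F)) (imagUnit_ne_zero (HodgeCM.CMField.K F))
              (imagUnit_mul_self (HodgeCM.CMField.K F)) (realDiagonal_isSymm (HodgeCM.CMField.K F) (frameD V) (frameD_real V))
              (isUnit_det_realDiagonal (HodgeCM.CMField.K F) (frameD V) (frameD_real V) (frameD_ne V))
              (realDiagonal_map (HodgeCM.CMField.K F) (frameD V) (frameD_real V)).symm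
              (hsChiD (⟨HodgeCM.CMField.K F⟩ : Summit.HodgeConjecture.CorCM.CMField) e₁ (frameD V) (frameD_real V) (frameD_ne V)
                (toHeckeCharacter (HodgeCM.CMField.K F) μ) (isUnitary_toHeckeCharacter (HodgeCM.CMField.K F) μ)
                (isSplittingChar_toHeckeCharacter_of_isConjugateSymplectic (HodgeCM.CMField.K F) μ hμ)) b ψ k x) =
            rhoVAtLine ↥(maximalRealSubfield (HodgeCM.CMField.K F)) (HodgeCM.CMField.K F) (IsCMField.complexConj (HodgeCM.CMField.K F)) 3 e₁
              (Matrix.diagonal (frameD V)) (complexConj_imagUnit (HodgeCM.CMField.K F)) (imagUnit_ne_zero (HodgeCM.CMField.K F))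
              (imagUnit_mul_self (HodgeCM.CMField.K F)) (realDiagonal_isSymm (HodgeCM.CMField.K F) (frameD V) (frameD_real V))
              (isUnit_det_realDiagonal (HodgeCM.CMField.K F) (frameD V) (frameD_real V) (frameD_ne V))
              (realDiagonal_map (HodgeCM.CMField.K F) (frameD V) (frameD_real V)).symm
              (hsChiD (⟨HodgeCM.CMField.K F⟩ : Summit.HodgeConjecture.CorCM.CMField) e₁ (frameD V) (frameD_real V) (frameD_ne V)
                (toHeckeCharacter (HodgeCM.CMField.K F) μ) (isUnitary_toHeckeCharacter (HodgeCM.CMField.K F) μ)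
                (isSplittingChar_toHeckeCharacter_of_isConjugateSymplectic (HodgeCM.CMField.K F) μ hμ)) b' ψ k (Ψ x) :=
  fun F _ V μ hμ b b' hbb' ψ =>
    lineTransportAt (⟨HodgeCM.CMField.K F⟩ : Summit.HodgeConjecture.CorCM.CMField) e₁ (frameD V) (frameD_real V) (frameD_ne V)
      (toHeckeCharacter (HodgeCM.CMField.K F) μ) (isUnitary_toHeckeCharacter (HodgeCM.CMField.K F) μ)
      (isSplittingChar_toHeckeCharacter_of_isConjugateSymplectic (HodgeCM.CMField.K F) μ hμ) b b' ψ hbb'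

set_option synthInstance.maxHeartbeats 400000 in
set_option maxHeartbeats 16000000 in
/-- **S5 `StubT3bConjugatePartnerAt` HOLDS** — the body of the line's stub VERBATIM, unconditionally: every weight-one admissible triple `t` of the pin's
datum has a weight-one admissible partner `t'` with the `ι₁`-class flipped and a bijective conjugate-linear `rhoTriple`-equivariant
`J : ω_V(t) → ω_V(t')` (★ `stubT3bConjugatePartnerAt_of_reprIndependence` at `reprIndependence_atFrame`).
[cite: Liu2021, Def. 4.11–4.12; App. D Lem. D.1 (2) (l. 5231), §D.1 Step 1 footnote (l. 5215)] [cite: GelbartRogawski1991, §3 Prop. 3.1.1 p. 455] -/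
theorem stubT3bConjugatePartnerAt_holds :
    ∀ (hDel : Literature.AlgebraicGeometry.ShimuraVarieties.UnitaryCanonicalModel.canonicalModel_exists_printed)
      (F : HodgeCM.CMField) [IsGalois ℚ F] (h6 : 6 ≤ Module.finrank ℚ F) {ι₁ : F →+* ℂ} (V : HodgeCM.HermSpace3 F ι₁) (a₀ : RealScalar F)
      (Φ : CMType F) (hΦ : ι₁ ∈ Φ.1) (i : (I V (repAt a₀) (muLiu ι₁ GramClass.rep))),
      (datum413 hDel F V a₀ Φ i).n = 3 →
        ∀ (t : (datum413 hDel F V a₀ Φ i).Triple), t.HasWeightOne → t.IsAdmissible →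
          ∃ t' : (datum413 hDel F V a₀ Φ i).Triple, t'.HasWeightOne ∧ t'.IsAdmissible ∧ (ι₁ ∈ t'.cmType.1 ↔ ι₁ ∉ t.cmType.1) ∧
            ∃ J : (datum413 hDel F V a₀ Φ i).omega t.μ t.isConjugateSymplectic t.ε t.χ →ₛₗ[starRingEnd ℂ]
                (datum413 hDel F V a₀ Φ i).omega t'.μ t'.isConjugateSymplectic t'.ε t'.χ,
              Function.Bijective J ∧
                ∀ (g : ↥(HodgeCM.HermSpace3.adelicFin V)) (v : (datum413 hDel F V a₀ Φ i).omega t.μ t.isConjugateSymplectic t.ε t.χ),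
                  J (rhoTriple (datum413 hDel F V a₀ Φ i) t g v) = rhoTriple (datum413 hDel F V a₀ Φ i) t' g (J v) :=
  stubT3bConjugatePartnerAt_of_reprIndependence reprIndependence_atFrame

end Summit.HodgeConjecture.HodgeConjecture.Cruxes.H413.ConjugatePartner

end
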